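import Summits.QuantumFields.BalabanUV.T4Continuum.Support.NE7CriticalFirstVariationGeneral
import HarnessLib

/-!
# NE7CriticalPairingQbar — THE CRITICAL PAIRING LETTER WITH THE DOUBLE-BAR AVERAGE: for a TANGENT-CRITICAL configuration `U` of the multi-level class, AT ANY TOP,
# `|dAction U Z (perWin)| ≤ c_R·Σ_{w ∈ periodBox N} Σ_τ ‖Q̄^{(k+1)}_U Z (w,τ)‖` for every skew periodic `Z` — F244 §2 with the `ℓ¹` letter of `Q̄_U` NOT applied (the
# bound is kept in terms of the coarse double-bar average itself, so that a consumer may split `Q̄_U Z = (Q̄_U − Q̄_1)Z + Q̄_1 Z` and use `Q̄_1 Z = 0` on straight tangents)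

Cell `pub-balaban`, rung (B)+1 sub-cell t4, lineage `b2b-balaban-t4-ne7-p1` (CRUX PROVER NE7 #1 = OWNER of row NE7), generation 89; memo
`t4/b2b-balaban-t4-ne7-p1-g89/COSTING-N1.md` §7 ((N2)-straight, brick B1).  File F264 (over F244 `NE7CriticalFirstVariationGeneral` (`dirIter_add_gaugeDir_eq_Qbar_general`,
and §3's instantiation of `R := rightInvW` verbatim), F53∕g62 letters `abs_dAction_rightInvW_le`, row NE3's right inverse `rightInvW`).

WHY (memo §7).  The two-region criticality defect of the torus road v4 pairs `dAction_{U′}(χ′Y)` through criticality of `U′`; F244 gives `|dAction U Z| ≤ c_R·Λ_U·‖Z‖₁`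
with the GLOBAL `ℓ¹` letter `Λ_U` of `Q̄_U` — too coarse: the defect must exhibit the small factor `Mα₀` of `(Q̄_{U′} − Q̄_1)` and the vanishing of `Q̄_1Y` on straight
tangents.  THIS FILE stops F244's proof one line earlier.
WHAT ([folklore]; 0 def, 0 sorry; generic `d`).
§1 **`abs_dAction_le_cR_sum_norm_QbarIter`** — abstract exact right inverse `R` with first-variation bound `c_R`, `U` tangent-critical, ANY top: for every skew
   `T`-periodic `Z` (`T = L^{k+1}N`), `|dAction U Z (perWin d T)| ≤ c_R·Σ_{w ∈ periodBox N} Σ_τ ‖QbarIter L (k+1) U Z w τ‖`.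
§2 **`abs_dAction_le_cR_sum_norm_QbarIter_rightInvW`** — `R := rightInvW`: `c_R = a·(curl1C∕(1 − θ_loc·M²x))·(M^d∕M²)` (F53's letter), hypotheses as F244 §3.
HONEST FRAMING (page 1): composition of tree theorems; nothing of Bałaban's asserted; NOT (APE), NOT ONE-STEP, NOT NE7; spine 0∕9; finite T⁴ rung (B)+1 — NOT infinite
volume, NOT mass gap, NOT `BetaPertH`, NOT Clay.  Continuum YM on T⁴ ⇐ BetaPertH ∧ nine spine estimates (0/9 proved); BetaPertH ⇐ (D1) ∧ (D4) ∧ CAP+tail; G-an2-4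
gates asym, D1 and NE2/3/4.
-/

set_option autoImplicit false

open scoped BigOperators Matrix.Norms.L2Operator
open NormedSpace Finset

namespace Summit.QuantumFields.BalabanUV.T4Continuum.NE7CriticalPairingQbar

open Literature.MathematicalPhysics.QuantumFieldTheory.Balaban1983to89
open B7Prop1Explicit B7Prop2Explicit MatrixLog UnitaryModel
open T4AveragingDeficitWall (IsUnitaryCfg IsSkewDir SmallField dirL1)
open T4AveragingDeficitWallBoundary (IsPeriodicCfg periodBox)
open AveragingDeficitPeriodicCounting (IsPeriodicDir)
open AveragingDeficitTwoLevelPrep (prop1Radius twoLevelSmall)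
open AveragingDeficitMultiLevelPrep (cavgIter LevelSmall tower)
open AveragingDeficitMultiLevelBridge (tower_eq)
open MinimalActionLevels (perWin)
open BlockAveragePushDirGauge (gaugeDir isPeriodicDir_gaugeDir)
open BlockAverageVaryHolo (nbRad)
open NE3TangentCovariantTower (dirIter QbarIter framePotW dirIter_add dirIter_gaugeDir dirIter_eq_QbarIter_add_gaugeDir)
open NE3CurvedFrameKill (framePotW_skew_periodic pow_succ_mul_eq_tower)
open NE3LandauOrbit (gaugeDir_skew)
open NE3ResidualSliceRep (dirIter_sub)
open NE3HessForm (dAction)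
open NE3PureGaugeFirstVariation (dAction_gaugeDir)
open NE3QbarIterCovLiftPrep (cruxC)
open NE3SmoothRightInverseW (rightInvW)
open NE3RightInverseSolveLetters (thetaLoc)
open NE3HatInvCurlLetters (curl1C curl1C_nonneg)
open NE3RightInverseLetters (rightInvW_exact rightInvW_skew rightInvW_periodic)
open NE7TangentTransportGauge (dAction_sub' dirIter_skew_periodic cornerLift_smul cornerLift_add_period)
open NE7TangentTransportRightInv (abs_dAction_rightInvW_le)
open NE7QbarCurvedBaseTower (sum_norm_QbarIter_le_prod)
open NE7MajorantL1 (prod_step_le)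
open NE7SliceLetterBalabanGauge (gaugeDir_neg_pi)

open NE7CriticalFirstVariationGeneral (dirIter_add_gaugeDir_eq_Qbar_general)

noncomputable section

variable {d : ℕ} {n : Type*} [Fintype n] [DecidableEq n]

/-! ## §1 The pairing letter with `Q̄_U`, abstract right inverse -/

/-- **`|dAction U Z| ≤ c_R·‖Q̄_U Z‖_{ℓ¹(periodBox N)}` FOR A TANGENT-CRITICAL `U` AT ANY TOP** (abstract exact right inverse `R` of `D_U` on skew `N`-periodic coarse data
with first-variation bound `c_R`): F244 §2's chain `dAction_U Z = dAction_U(Z + gaugeDir_Uλ) = dAction_U(Rψ)`, `ψ = D_U(Z + gaugeDir_Uλ) = Q̄_U Z`, `|·| ≤ c_R‖ψ‖₁`,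
stopped before the `ℓ¹` letter of `Q̄_U`. [folklore] -/
theorem abs_dAction_le_cR_sum_norm_QbarIter [Nonempty n] {L N : ℕ} [NeZero N] (hL : 1 ≤ L) (k : ℕ)
    {U : Site d → Fin d → (Matrix n n ℂ)ˣ} {x : ℝ} (hUu : IsUnitaryCfg U) (hUP : IsPeriodicCfg U ((tower L N (k + 1) : ℕ) : ℤ))
    (hx : 0 ≤ x) (hs : LevelSmall d L k x) (hUx : SmallField U x)
    (R : (Site d → Fin d → Matrix n n ℂ) → Site d → Fin d → Matrix n n ℂ)
    (hRskew : ∀ φ : Site d → Fin d → Matrix n n ℂ, IsSkewDir φ → IsPeriodicDir φ (N : ℤ) → IsSkewDir (R φ))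
    (hRper : ∀ φ : Site d → Fin d → Matrix n n ℂ, IsSkewDir φ → IsPeriodicDir φ (N : ℤ) →
      IsPeriodicDir (R φ) ((tower L N (k + 1) : ℕ) : ℤ))
    (hRexact : ∀ φ : Site d → Fin d → Matrix n n ℂ, IsSkewDir φ → IsPeriodicDir φ (N : ℤ) → dirIter L (k + 1) U (R φ) = φ)
    {cR : ℝ}
    (hRbd : ∀ φ : Site d → Fin d → Matrix n n ℂ, IsSkewDir φ → IsPeriodicDir φ (N : ℤ) →
      |dAction U (R φ) (perWin d (tower L N (k + 1)))| ≤ cR * dirL1 φ (periodBox (d := d) N))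
    (hcrit : ∀ Y' : Site d → Fin d → Matrix n n ℂ, IsSkewDir Y' → IsPeriodicDir Y' ((tower L N (k + 1) : ℕ) : ℤ) →
      dirIter L (k + 1) U Y' = 0 → dAction U Y' (perWin d (tower L N (k + 1))) = 0)
    {Z : Site d → Fin d → Matrix n n ℂ} (hZ : IsSkewDir Z) (hZP : IsPeriodicDir Z ((tower L N (k + 1) : ℕ) : ℤ)) :
    |dAction U Z (perWin d (tower L N (k + 1)))| ≤ cR * ∑ w ∈ periodBox N, ∑ τ : Fin d, ‖QbarIter L (k + 1) U Z w τ‖ := by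
  have hm : ((L : ℤ) ^ (k + 1)) ≠ 0 := pow_ne_zero _ (by exact_mod_cast (show L ≠ 0 by omega))
  have htow : ((tower L N (k + 1) : ℕ) : ℤ) = (L : ℤ) ^ (k + 1) * (N : ℤ) := (pow_succ_mul_eq_tower L N k).symm
  -- the generator of F244 §1 and its letters
  set g : Site d → Matrix n n ℂ := fun w => -framePotW L (k + 1) U Z w with hg
  set lam : Site d → Matrix n n ℂ := fun xx => g (fun i => xx i / ((L : ℤ) ^ (k + 1))) with hlam
  obtain ⟨hFUs, hFUP⟩ := framePotW_skew_periodic (M := N) hL k hUu hUP hx hs hUx hZ hZP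
  have hgs : ∀ w, g w ∈ skewAdjoint (Matrix n n ℂ) := fun w => (skewAdjoint (Matrix n n ℂ)).neg_mem (hFUs w)
  have hgP : ∀ (w : Site d) (i : Fin d), g (w + (N : ℤ) • e i) = g w := fun w i => by simp only [hg, hFUP w i]
  have hlams : ∀ xx, lam xx ∈ skewAdjoint (Matrix n n ℂ) := fun xx => hgs _
  have hlamP : ∀ (y : Site d) (i : Fin d), lam (y + ((tower L N (k + 1) : ℕ) : ℤ) • e i) = lam y := fun y i => by
    rw [htow]; exact cornerLift_add_period g hm hgP y i
  -- the gauge-corrected direction `Z₁ = Z + gaugeDir_U λ` and its average `ψ = Q̄_U Z`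
  set G : Site d → Fin d → Matrix n n ℂ := gaugeDir U lam with hG
  have hGs : IsSkewDir G := gaugeDir_skew hUu hlams
  have hGP : IsPeriodicDir G ((tower L N (k + 1) : ℕ) : ℤ) := isPeriodicDir_gaugeDir hUP hlamP
  set Z₁ : Site d → Fin d → Matrix n n ℂ := fun y μ => Z y μ + G y μ with hZ₁
  have hZ₁s : IsSkewDir Z₁ := fun y μ => (skewAdjoint (Matrix n n ℂ)).add_mem (hZ y μ) (hGs y μ)
  have hZ₁P : IsPeriodicDir Z₁ ((tower L N (k + 1) : ℕ) : ℤ) := fun y i μ => by simp only [hZ₁, hZP y i μ, hGP y i μ]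
  set ψ : Site d → Fin d → Matrix n n ℂ := dirIter L (k + 1) U Z₁ with hψ
  obtain ⟨hψs, hψP⟩ := dirIter_skew_periodic (M := N) hL k hUu hUP hx hs hUx hZ₁s hZ₁P
  have hψeq : ∀ (w : Site d) (τ : Fin d), ψ w τ = QbarIter L (k + 1) U Z w τ :=
    fun w τ => dirIter_add_gaugeDir_eq_Qbar_general hL k hUu hUP hx hs hUx hZ hZP w τ
  -- the tangent field `Z₁ − Rψ` and criticality
  have hTs : IsSkewDir (fun y μ => Z₁ y μ - R ψ y μ) := fun y μ => (skewAdjoint (Matrix n n ℂ)).sub_mem (hZ₁s y μ) (hRskew ψ hψs hψP y μ)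
  have hTP : IsPeriodicDir (fun y μ => Z₁ y μ - R ψ y μ) ((tower L N (k + 1) : ℕ) : ℤ) := fun y i μ => by
    simp only [hZ₁P y i μ, hRper ψ hψs hψP y i μ]
  have hTT : dirIter L (k + 1) U (fun y μ => Z₁ y μ - R ψ y μ) = 0 := by
    rw [dirIter_sub hL k hUu hx hs hUx Z₁ (R ψ), hRexact ψ hψs hψP]
    funext w τ
    simp [hψ]
  have hc := hcrit _ hTs hTP hTT
  rw [dAction_sub', sub_eq_zero] at hc
  -- `dAction U Z = dAction U Z₁ = dAction U (Rψ)`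
  have hZZ₁ : dAction U Z (perWin d (tower L N (k + 1))) = dAction U Z₁ (perWin d (tower L N (k + 1))) := by
    have e1 : Z = fun y μ => Z₁ y μ - G y μ := by funext y μ; simp only [hZ₁]; abel
    conv_lhs => rw [e1]
    rw [dAction_sub', hG, dAction_gaugeDir, sub_zero]
  rw [hZZ₁, hc]
  refine (hRbd ψ hψs hψP).trans (le_of_eq ?_)
  -- `‖ψ‖₁ = ‖Q̄_U Z‖₁`
  have he : dirL1 ψ (periodBox (d := d) N) = ∑ w ∈ periodBox N, ∑ τ : Fin d, ‖QbarIter L (k + 1) U Z w τ‖ := by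
    unfold dirL1
    exact Finset.sum_congr rfl fun w _ => Finset.sum_congr rfl fun τ _ => by rw [hψeq]
  rw [he]

/-! ## §2 The letter at `R := rightInvW` — ANY top -/

/-- **`|dAction U Z| ≤ c_R·‖Q̄_U Z‖_{ℓ¹(periodBox N)}` WITH `R := rightInvW`** (`c_R = a·(curl1C∕(1−θ_loc M²x))·(M^d∕M²)`, F53's first-variation letter): for `U` unitary
`(N·L^{k+1})`-periodic with class radius `x ≥ 0`, `LevelSmall d L k x`, `cruxC·M²x < 1`, `thetaLoc·M²x < 1`, `M²x ≤ 1`, `SmallField U a`, `a ≥ 0`, `L ≥ 2`,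
TANGENT-CRITICAL, ANY top, and every skew `(N·L^{k+1})`-periodic `Z`. [folklore] -/
theorem abs_dAction_le_cR_sum_norm_QbarIter_rightInvW [Nonempty n] {L : ℕ} (hL : 2 ≤ L) (k : ℕ) {N : ℕ} [NeZero N]
    {U : Site d → Fin d → (Matrix n n ℂ)ˣ} {x a : ℝ}
    (hUu : IsUnitaryCfg U) (hUP : IsPeriodicCfg U ((N * L ^ (k + 1) : ℕ) : ℤ)) (hx : 0 ≤ x) (hs : LevelSmall d L k x) (hUx : SmallField U x)
    (hθ : cruxC d L * (((L : ℝ) ^ (k + 1)) ^ 2 * x) < 1) (hθl : thetaLoc d L * (((L : ℝ) ^ (k + 1)) ^ 2 * x) < 1)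
    (hε : ((L : ℝ) ^ (k + 1)) ^ 2 * x ≤ 1) (ha : 0 ≤ a) (hUa : SmallField U a)
    (hcrit : ∀ Y' : Site d → Fin d → Matrix n n ℂ, IsSkewDir Y' → IsPeriodicDir Y' ((N * L ^ (k + 1) : ℕ) : ℤ) →
      dirIter L (k + 1) U Y' = 0 → dAction U Y' (perWin d (N * L ^ (k + 1))) = 0)
    {Z : Site d → Fin d → Matrix n n ℂ} (hZ : IsSkewDir Z) (hZP : IsPeriodicDir Z ((N * L ^ (k + 1) : ℕ) : ℤ)) :
    |dAction U Z (perWin d (N * L ^ (k + 1)))|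
      ≤ (a * ((curl1C d L / (1 - thetaLoc d L * (((L : ℝ) ^ (k + 1)) ^ 2 * x))) * (((L : ℝ) ^ (k + 1)) ^ d / ((L : ℝ) ^ (k + 1)) ^ 2)))
        * ∑ w ∈ periodBox N, ∑ τ : Fin d, ‖QbarIter L (k + 1) U Z w τ‖ := by
  classical
  have hL1 : 1 ≤ L := le_trans (by norm_num) hL
  have htowN : tower L N (k + 1) = N * L ^ (k + 1) := tower_eq L N (k + 1)
  have htow : ((tower L N (k + 1) : ℕ) : ℤ) = ((N * L ^ (k + 1) : ℕ) : ℤ) := by rw [htowN]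
  have hUP' : IsPeriodicCfg U ((tower L N (k + 1) : ℕ) : ℤ) := by rw [htow]; exact hUP
  -- the right inverse as a plain function (classical case split on skewness), as F53 ∕ g72 ∕ F244
  set R : (Site d → Fin d → Matrix n n ℂ) → Site d → Fin d → Matrix n n ℂ :=
    fun φ => if h : IsSkewDir φ then rightInvW hL k hUu hx hs hUx N hθ h else 0 with hR
  have hRdef : ∀ φ : Site d → Fin d → Matrix n n ℂ, ∀ h : IsSkewDir φ, R φ = rightInvW hL k hUu hx hs hUx N hθ h := fun φ h => by
    simp only [hR, dif_pos h]
  set cR : ℝ := a * ((curl1C d L / (1 - thetaLoc d L * (((L : ℝ) ^ (k + 1)) ^ 2 * x))) * (((L : ℝ) ^ (k + 1)) ^ d / ((L : ℝ) ^ (k + 1)) ^ 2))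
    with hcR
  have hRskew : ∀ φ : Site d → Fin d → Matrix n n ℂ, IsSkewDir φ → IsPeriodicDir φ (N : ℤ) → IsSkewDir (R φ) := fun φ hφ _ => by
    rw [hRdef φ hφ]; exact rightInvW_skew hL k hUu hx hs hUx hθ hφ
  have hRper : ∀ φ : Site d → Fin d → Matrix n n ℂ, IsSkewDir φ → IsPeriodicDir φ (N : ℤ) →
      IsPeriodicDir (R φ) ((tower L N (k + 1) : ℕ) : ℤ) := fun φ hφ _ => by
    rw [hRdef φ hφ, htow]; exact rightInvW_periodic hL k hUu hUP' hx hs hUx hθ hφ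
  have hRexact : ∀ φ : Site d → Fin d → Matrix n n ℂ, IsSkewDir φ → IsPeriodicDir φ (N : ℤ) → dirIter L (k + 1) U (R φ) = φ := fun φ hφ hφP => by
    rw [hRdef φ hφ]; exact rightInvW_exact hL k hUu hUP' hx hs hUx hθ hφ hφP
  have hRbd : ∀ φ : Site d → Fin d → Matrix n n ℂ, IsSkewDir φ → IsPeriodicDir φ (N : ℤ) →
      |dAction U (R φ) (perWin d (tower L N (k + 1)))| ≤ cR * dirL1 φ (periodBox (d := d) N) := fun φ hφ hφP => by
    rw [hRdef φ hφ, htowN]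
    exact abs_dAction_rightInvW_le hL k hUu hUP' hx hs hUx hθ hθl hε ha hUa hφ
  have hcrit' : ∀ Y' : Site d → Fin d → Matrix n n ℂ, IsSkewDir Y' → IsPeriodicDir Y' ((tower L N (k + 1) : ℕ) : ℤ) →
      dirIter L (k + 1) U Y' = 0 → dAction U Y' (perWin d (tower L N (k + 1))) = 0 := fun Y' hY's hY'P hY'T => by
    rw [htowN]; rw [htow] at hY'P; exact hcrit Y' hY's hY'P hY'T
  have hZP' : IsPeriodicDir Z ((tower L N (k + 1) : ℕ) : ℤ) := by rw [htow]; exact hZP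
  have h := abs_dAction_le_cR_sum_norm_QbarIter hL1 k hUu hUP' hx hs hUx R hRskew hRper hRexact hRbd hcrit' hZ hZP'
  rw [htowN] at h
  simpa only [hcR] using h

end

end Summit.QuantumFields.BalabanUV.T4Continuum.NE7CriticalPairingQbar
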